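import Summits.CriticalPhenomena.PercolationContinuityZ3.Theorems.PercNearOneGluingNoHeavyQuantFarTreeBlockCombStrong
import Summits.CriticalPhenomena.PercolationContinuityZ3.Theorems.PercNearOneGluingNoHeavyQuantFarTreeRow
import HarnessLib

/-!
# QUANT lane R8: FAR at every layer for block-combs in the strong regime — ROUTE VOCABULARY (tree-supported bond weights on `Sym2 (Fin n)`)

builds on p205010 (kernel theorem, internal audit signed; external expert review pending)

Support file (`--supports stmt-CriticalPhenomena-4575`), QUANT lane seat prim-quant-p1 (gen 8); memo `run/shared/lean/prim/quant/P1-SURPLUS.md` §19.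
The wrapper of `Quant.BlockCombGate.farTree_blockComb_strong_sizes` (`…QuantFarTreeBlockCombStrong.lean`) along `Quant.tree_relayCount_transfer` /
`Quant.tree_real_openConn_eq_prod`, in the pattern of `Quant.farRelayRow_tree_blockComb_cell` (p1 g7).  Theorems only; no sorries; standard axioms.

* `Quant.farRelayRow_tree_blockComb_strong` — **body of `Quant.FarRelayRow` at EVERY layer, with the mean hypothesis replaced by the STRONG one**, for
  every weight function on `Sym2 (Fin n)` supported on a rooted spanning tree (`par`/`depth` coordinates, root = observer `o ∉ A`) that carries a
  BLOCK-COMB PRESENTATION: a chain `ch : Fin D → Fin n` of tree vertices, classes `k : κ` of relays `R k ⊆ A` (pairwise disjoint) with pairwise disjoint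
  private vertex sets `G k` off the chain and levels `lv k ≤ D`, such that the root path of every relay of class `k` is exactly `ch''{i < lv k} ∪ G k`
  (N21 (0)'s block-combs: the least likely relay's chain with glued classes hanging off it by private paths, root-level classes, the terminal block).
  If `2j < (Σ_k |R k|)·∏_{y ∈ G k} w(par y, y)` for every nonempty class (the strong regime — for ALL-TIED block-combs this is `EN > 2j`) and
  `P(o ↮ b) ≤ t` on `A`, then `P(#{b ∈ A | o ↔ b} ≤ j) ≤ t`.
[cite: KozmaNitzan2024, Lemma 2 (p. 6), Conjecture 3 (p. 15)]; the family theorem is [this work].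
-/

noncomputable section

namespace Summit.CriticalPhenomena.PercolationContinuityZ3.Theorems

namespace Quant

open Finset MeasureTheory
open Literature.Probability.LatticeModels
open Literature.Probability.Percolation
open scoped Classical

variable {n : ℕ}

/-- **FAR at every layer for block-combs in the strong regime, route vocabulary.**  Tree-supported weights `w` on `Sym2 (Fin n)` (root `o`, coordinates
`par`/`depth`, `hsupp`), relays `A ∌ o`, and a block-comb presentation (`ch`, `R`, `G`, `lv`) of some of the relays: chain `ch`
(injective), classes `R k ⊆ A` pairwise disjoint, private vertex sets `G k ∌ o` pairwise disjoint and off the chain, `lv k ≤ D`, and for every `b ∈ R k`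
the root path `{par^[i] b | i ≤ depth b}` equals `ch''{i < lv k} ∪ G k`.  If `2j < (Σ_k |R k|)·∏_{y∈G k} w(s(par y, y))` for every nonempty class and
`P(o ↮ b) ≤ t` for all `b ∈ A`, then `P(#{b ∈ A | o ↔ b} ≤ j) ≤ t`. [this work] -/
theorem farRelayRow_tree_blockComb_strong (n : ℕ) (w : Sym2 (Fin n) → unitInterval) (o : Fin n)
    (depth : Fin n → ℕ) (par : Fin n → Fin n)
    (hroot : ∀ x, x ≠ o → depth x = 0 → par x = o)
    (hstep : ∀ x, x ≠ o → depth x ≠ 0 → par x ≠ o ∧ depth (par x) + 1 = depth x)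
    (hsupp : ∀ e, w e ≠ 0 → e.IsDiag ∨ ∃ x, x ≠ o ∧ e = s(par x, x))
    (A : Finset (Fin n)) (hoA : o ∉ A) (j : ℕ) (t : ℝ)
    {κ : Type*} [Fintype κ] [DecidableEq κ]
    (D : ℕ) (ch : Fin D → Fin n) (hch : Function.Injective ch)
    (G : κ → Finset (Fin n)) (hGdisj : ∀ k k', k ≠ k' → Disjoint (G k) (G k')) (hGch : ∀ k (i : Fin D), ch i ∉ G k)
    (hGo : ∀ k, o ∉ G k)
    (R : κ → Finset (Fin n)) (hRA : ∀ k, R k ⊆ A) (hRdisj : ∀ k k', k ≠ k' → Disjoint (R k) (R k'))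
    (lv : κ → ℕ) (hlv : ∀ k, lv k ≤ D)
    (hpath : ∀ k, ∀ b ∈ R k, (Finset.range (depth b + 1)).image (fun i => par^[i] b) =
      ((Finset.univ : Finset (Fin D)).filter (fun i : Fin D => i.val < lv k)).image ch ∪ G k)
    (hstrong : ∀ k, (R k).Nonempty → (2 * j : ℝ) < (∑ k', ((R k').card : ℝ)) * ∏ y ∈ G k, (w s(par y, y) : ℝ))
    (hne : ∃ k, (R k).Nonempty)
    (ht : ∀ b ∈ A, (prodBernoulli w).real (openConn o b : Set (BondConfig (Fin n)))ᶜ ≤ t) :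
    (prodBernoulli w).real {ω : BondConfig (Fin n) | (A.filter fun b => ω ∈ openConn o b).card ≤ j} ≤ t := by
  rw [tree_relayCount_transfer n w o depth par hroot hstep hsupp A j]
  set q : Fin n → unitInterval := fun x => if x = o then 1 else w s(par x, x) with hq
  have hqy : ∀ y, y ≠ o → q y = w s(par y, y) := fun y hy => by simp only [hq, if_neg hy]
  have hAo : ∀ b ∈ A, b ≠ o := fun b hb hbo => hoA (hbo ▸ hb)
  -- the reached-class event contains the light relay-count event
  set F : Set (Set (Fin n)) := {ω' : Set (Fin n) | ∑ k ∈ Finset.univ.filter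
      (fun k => (∀ i : Fin D, (i : ℕ) < lv k → ch i ∈ ω') ∧ ((G k : Finset (Fin n)) : Set (Fin n)) ⊆ ω'), (R k).card ≤ j} with hF
  have hsub : {ω' : Set (Fin n) | (A.filter fun a => a = o ∨ ∀ i, i ≤ depth a → par^[i] a ∈ ω').card ≤ j} ⊆ F := by
    intro ω' hω'
    have hle : (A.filter fun a => a = o ∨ ∀ i, i ≤ depth a → par^[i] a ∈ ω').card ≤ j := hω'
    show ∑ k ∈ Finset.univ.filter
      (fun k => (∀ i : Fin D, (i : ℕ) < lv k → ch i ∈ ω') ∧ ((G k : Finset (Fin n)) : Set (Fin n)) ⊆ ω'), (R k).card ≤ j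
    set Kr : Finset κ := Finset.univ.filter
      (fun k => (∀ i : Fin D, (i : ℕ) < lv k → ch i ∈ ω') ∧ ((G k : Finset (Fin n)) : Set (Fin n)) ⊆ ω') with hKr
    -- every relay of a reached class is a reached relay
    have hreach : ∀ k ∈ Kr, ∀ b ∈ R k, (b = o ∨ ∀ i, i ≤ depth b → par^[i] b ∈ ω') := by
      intro k hk b hb
      obtain ⟨-, hpre, hG⟩ := Finset.mem_filter.1 hk
      refine Or.inr fun i hi => ?_
      have hmem : par^[i] b ∈ (Finset.range (depth b + 1)).image (fun i => par^[i] b) :=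
        Finset.mem_image.2 ⟨i, Finset.mem_range.2 (by omega), rfl⟩
      rw [hpath k b hb, Finset.mem_union] at hmem
      rcases hmem with h | h
      · obtain ⟨i', hi', he⟩ := Finset.mem_image.1 h
        rw [← he]
        exact hpre i' (Finset.mem_filter.1 hi').2
      · exact hG (Finset.mem_coe.2 h)
    have hcard : ∑ k ∈ Kr, (R k).card = (Kr.biUnion R).card := by
      rw [Finset.card_biUnion]
      intro k _ k' _ hkk'
      exact hRdisj k k' hkk'
    have hsubset : Kr.biUnion R ⊆ A.filter fun a => a = o ∨ ∀ i, i ≤ depth a → par^[i] a ∈ ω' := by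
      intro b hb
      obtain ⟨k, hk, hbk⟩ := Finset.mem_biUnion.1 hb
      exact Finset.mem_filter.2 ⟨hRA k hbk, hreach k hk b hbk⟩
    calc ∑ k ∈ Kr, (R k).card = (Kr.biUnion R).card := hcard
      _ ≤ (A.filter fun a => a = o ∨ ∀ i, i ≤ depth a → par^[i] a ∈ ω').card := Finset.card_le_card hsubset
      _ ≤ j := hle
  refine le_trans (measureReal_mono hsub (measure_ne_top _ _)) ?_
  -- hypotheses of the gate-coordinate theorem
  have hqG : ∀ k, ∏ e ∈ G k, (q e : ℝ) = ∏ y ∈ G k, (w s(par y, y) : ℝ) := fun k =>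
    Finset.prod_congr rfl fun y hy => by rw [hqy y (fun h => hGo k (h ▸ hy))]
  have hlive : ∀ k, 0 < (R k).card ↔ (R k).Nonempty := fun k => Finset.card_pos
  have hstrong' : ∀ k, 0 < (R k).card → (2 * j : ℝ) < (∑ k', ((R k').card : ℝ)) * ∏ e ∈ G k, (q e : ℝ) := by
    intro k hk; rw [hqG k]; exact hstrong k ((hlive k).1 hk)
  have hne' : ∃ k, 0 < (R k).card := by obtain ⟨k, hk⟩ := hne; exact ⟨k, (hlive k).2 hk⟩
  -- the marginal of a class is the marginal of each of its relays
  have ht' : ∀ k, 0 < (R k).card →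
      1 - (∏ i ∈ Finset.range (lv k), (if h : i < D then ((q (ch ⟨i, h⟩) : unitInterval) : ℝ) else 1)) *
        ∏ e ∈ G k, (q e : ℝ) ≤ t := by
    intro k hk
    obtain ⟨b, hb⟩ := (hlive k).1 hk
    have hbA : b ∈ A := hRA k hb
    have hbo : b ≠ o := hAo b hbA
    have htb := ht b hbA
    rw [probReal_compl_eq_one_sub (Set.toFinite _).measurableSet,
      tree_real_openConn_eq_prod n w o depth par hroot hstep hsupp b hbo] at htb
    -- rewrite the path product through the presentation
    have hprod : ∏ i ∈ Finset.range (depth b + 1), (w s(par (par^[i] b), par^[i] b) : ℝ) =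
        ∏ y ∈ (Finset.range (depth b + 1)).image (fun i => par^[i] b), (q y : ℝ) := by
      rw [Finset.prod_image (tree_iterate_injOn o depth par hstep b hbo)]
      refine Finset.prod_congr rfl fun i hi => ?_
      have hne := (tree_iterate_par o depth par hstep b hbo i (by have := Finset.mem_range.1 hi; omega)).1
      rw [hqy _ hne]
    have hdisj : Disjoint (((Finset.univ : Finset (Fin D)).filter (fun i : Fin D => i.val < lv k)).image ch) (G k) := by
      rw [Finset.disjoint_left]
      intro y hy hyG
      obtain ⟨i, -, rfl⟩ := Finset.mem_image.1 hy
      exact hGch k i hyG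
    have hrange : ∏ i ∈ Finset.range (lv k), (if h : i < D then ((q (ch ⟨i, h⟩) : unitInterval) : ℝ) else 1) =
        ∏ i ∈ Finset.range D, (if i < lv k then
          (if h : i < D then ((q (ch ⟨i, h⟩) : unitInterval) : ℝ) else 1) else 1) := by
      rw [← Finset.prod_filter]
      refine Finset.prod_congr ?_ fun _ _ => rfl
      ext i; simp only [Finset.mem_range, Finset.mem_filter]; have := hlv k; omega
    have hchain : ∏ y ∈ ((Finset.univ : Finset (Fin D)).filter (fun i : Fin D => i.val < lv k)).image ch, (q y : ℝ) =
        ∏ i ∈ Finset.range (lv k), (if h : i < D then ((q (ch ⟨i, h⟩) : unitInterval) : ℝ) else 1) := by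
      rw [Finset.prod_image (fun i _ i' _ h => hch h), Finset.prod_filter, hrange,
        ← Fin.prod_univ_eq_prod_range (fun m => if m < lv k then
          (if h : m < D then ((q (ch ⟨m, h⟩) : unitInterval) : ℝ) else 1) else 1) D]
      refine Finset.prod_congr rfl fun i _ => ?_
      by_cases hi : (i : ℕ) < lv k
      · rw [if_pos hi, if_pos hi, dif_pos i.2]
      · rw [if_neg hi, if_neg hi]
    rw [hprod, hpath k b hb, Finset.prod_union hdisj, hchain] at htb
    exact htb
  exact BlockCombGate.farTree_blockComb_strong_sizes q D ch hch G hGdisj hGch lv hlv (fun k => (R k).card) j t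
    hstrong' hne' ht'

/-- **FAR at every layer for every ALL-TIED block-comb, route vocabulary, under FAR's own hypothesis.**  If the presentation covers `A`
(`A = ⋃ R k`) and all relays have the same marginal `P(o ↔ b)` (all-tied), then `2j < Σ_{b∈A} P(o ↔ b)` and `P(o ↮ b) ≤ t` on `A` give
`P(#{b ∈ A | o ↔ b} ≤ j) ≤ t` — the body of `Quant.FarRelayRow` for this family (the interior extremal structure of LEAD-NOTES-G10 N21 (7b)
within block-combs).  Proof: tied + covering turn the mean hypothesis into the strong one of `farRelayRow_tree_blockComb_strong`. [this work] -/
theorem farRelayRow_tree_blockComb_tied (n : ℕ) (w : Sym2 (Fin n) → unitInterval) (o : Fin n)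
    (depth : Fin n → ℕ) (par : Fin n → Fin n)
    (hroot : ∀ x, x ≠ o → depth x = 0 → par x = o)
    (hstep : ∀ x, x ≠ o → depth x ≠ 0 → par x ≠ o ∧ depth (par x) + 1 = depth x)
    (hsupp : ∀ e, w e ≠ 0 → e.IsDiag ∨ ∃ x, x ≠ o ∧ e = s(par x, x))
    (A : Finset (Fin n)) (hoA : o ∉ A) (j : ℕ) (t : ℝ)
    {κ : Type*} [Fintype κ] [DecidableEq κ]
    (D : ℕ) (ch : Fin D → Fin n) (hch : Function.Injective ch)
    (G : κ → Finset (Fin n)) (hGdisj : ∀ k k', k ≠ k' → Disjoint (G k) (G k')) (hGch : ∀ k (i : Fin D), ch i ∉ G k)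
    (hGo : ∀ k, o ∉ G k)
    (R : κ → Finset (Fin n)) (hRA : ∀ k, R k ⊆ A) (hRdisj : ∀ k k', k ≠ k' → Disjoint (R k) (R k'))
    (hcover : ∀ b ∈ A, ∃ k, b ∈ R k)
    (lv : κ → ℕ) (hlv : ∀ k, lv k ≤ D)
    (hpath : ∀ k, ∀ b ∈ R k, (Finset.range (depth b + 1)).image (fun i => par^[i] b) =
      ((Finset.univ : Finset (Fin D)).filter (fun i : Fin D => i.val < lv k)).image ch ∪ G k)
    (htied : ∀ b ∈ A, ∀ b' ∈ A, (prodBernoulli w).real (openConn o b) = (prodBernoulli w).real (openConn o b'))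
    (hEN : (2 * j : ℝ) < ∑ b ∈ A, (prodBernoulli w).real (openConn o b))
    (ht : ∀ b ∈ A, (prodBernoulli w).real (openConn o b : Set (BondConfig (Fin n)))ᶜ ≤ t) :
    (prodBernoulli w).real {ω : BondConfig (Fin n) | (A.filter fun b => ω ∈ openConn o b).card ≤ j} ≤ t := by
  set q : Fin n → unitInterval := fun x => if x = o then 1 else w s(par x, x) with hq
  have hqy : ∀ y, y ≠ o → q y = w s(par y, y) := fun y hy => by simp only [hq, if_neg hy]
  have hAo : ∀ b ∈ A, b ≠ o := fun b hb hbo => hoA (hbo ▸ hb)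
  -- `Σ_k |R k| = |A|`
  have hcardA : ∑ k, ((R k).card : ℝ) = (A.card : ℝ) := by
    have hU : (Finset.univ : Finset κ).biUnion R = A := by
      refine Finset.Subset.antisymm (Finset.biUnion_subset.2 fun k _ => hRA k) fun b hb => ?_
      obtain ⟨k, hk⟩ := hcover b hb
      exact Finset.mem_biUnion.2 ⟨k, Finset.mem_univ _, hk⟩
    have h := Finset.card_biUnion (s := (Finset.univ : Finset κ)) (t := R) (fun k _ k' _ hkk' => hRdisj k k' hkk')
    rw [hU] at h
    rw [h]; push_cast; rfl
  -- a nonempty class exists (the relay set is nonempty since `2j < EN` forces it) and the strong hypothesis holds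
  have hAne : A.Nonempty := by
    rw [Finset.nonempty_iff_ne_empty]; intro hA
    rw [hA, Finset.sum_empty] at hEN
    have : (0 : ℝ) ≤ 2 * j := by positivity
    linarith
  obtain ⟨b₁, hb₁⟩ := hAne
  have hne : ∃ k, (R k).Nonempty := by obtain ⟨k, hk⟩ := hcover b₁ hb₁; exact ⟨k, ⟨b₁, hk⟩⟩
  have hstrong : ∀ k, (R k).Nonempty → (2 * j : ℝ) < (∑ k', ((R k').card : ℝ)) * ∏ y ∈ G k, (w s(par y, y) : ℝ) := by
    intro k ⟨b₀, hb₀⟩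
    have hb₀A : b₀ ∈ A := hRA k hb₀
    have hb₀o : b₀ ≠ o := hAo b₀ hb₀A
    -- the mean is `|A| · P(o ↔ b₀)`
    have hENeq : ∑ b ∈ A, (prodBernoulli w).real (openConn o b) = (A.card : ℝ) * (prodBernoulli w).real (openConn o b₀) := by
      rw [Finset.sum_congr rfl fun b hb => htied b hb b₀ hb₀A, Finset.sum_const, nsmul_eq_mul]
    -- `P(o ↔ b₀) ≤ ∏_{G k} w`
    have hmarg : (prodBernoulli w).real (openConn o b₀) ≤ ∏ y ∈ G k, (w s(par y, y) : ℝ) := by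
      rw [tree_real_openConn_eq_prod n w o depth par hroot hstep hsupp b₀ hb₀o]
      have hprod : ∏ i ∈ Finset.range (depth b₀ + 1), (w s(par (par^[i] b₀), par^[i] b₀) : ℝ) =
          ∏ y ∈ (Finset.range (depth b₀ + 1)).image (fun i => par^[i] b₀), (q y : ℝ) := by
        rw [Finset.prod_image (tree_iterate_injOn o depth par hstep b₀ hb₀o)]
        refine Finset.prod_congr rfl fun i hi => ?_
        have hne' := (tree_iterate_par o depth par hstep b₀ hb₀o i (by have := Finset.mem_range.1 hi; omega)).1
        rw [hqy _ hne']
      have hqG : ∏ y ∈ G k, (w s(par y, y) : ℝ) = ∏ y ∈ G k, (q y : ℝ) :=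
        Finset.prod_congr rfl fun y hy => by rw [hqy y (fun h => hGo k (h ▸ hy))]
      rw [hprod, hqG, hpath k b₀ hb₀]
      exact Finset.prod_le_prod_of_subset_of_le_one Finset.subset_union_right (fun y _ => (q y).2.1) fun y _ _ => (q y).2.2
    have hpos : 0 ≤ ∑ k', ((R k').card : ℝ) := Finset.sum_nonneg fun _ _ => Nat.cast_nonneg _
    calc (2 * j : ℝ) < ∑ b ∈ A, (prodBernoulli w).real (openConn o b) := hEN
      _ = (∑ k', ((R k').card : ℝ)) * (prodBernoulli w).real (openConn o b₀) := by rw [hENeq, hcardA]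
      _ ≤ (∑ k', ((R k').card : ℝ)) * ∏ y ∈ G k, (w s(par y, y) : ℝ) := mul_le_mul_of_nonneg_left hmarg hpos
  exact farRelayRow_tree_blockComb_strong n w o depth par hroot hstep hsupp A hoA j t D ch hch G hGdisj hGch hGo R hRA
    hRdisj lv hlv hpath hstrong hne ht

/-- **The `o ∈ A` cell** of `Quant.farRelayRow_tree_blockComb_strong`: the observer itself a relay (always counted); the presentation describes classes of
`A.erase o` and the strong hypothesis is taken at the shifted layer `j − 1` (for `j = 0` the light event is empty). [this work] -/
theorem farRelayRow_tree_blockComb_strong_root (n : ℕ) (w : Sym2 (Fin n) → unitInterval) (o : Fin n)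
    (depth : Fin n → ℕ) (par : Fin n → Fin n)
    (hroot : ∀ x, x ≠ o → depth x = 0 → par x = o)
    (hstep : ∀ x, x ≠ o → depth x ≠ 0 → par x ≠ o ∧ depth (par x) + 1 = depth x)
    (hsupp : ∀ e, w e ≠ 0 → e.IsDiag ∨ ∃ x, x ≠ o ∧ e = s(par x, x))
    (A : Finset (Fin n)) (hoA : o ∈ A) (j : ℕ) (t : ℝ)
    {κ : Type*} [Fintype κ] [DecidableEq κ]
    (D : ℕ) (ch : Fin D → Fin n) (hch : Function.Injective ch)
    (G : κ → Finset (Fin n)) (hGdisj : ∀ k k', k ≠ k' → Disjoint (G k) (G k')) (hGch : ∀ k (i : Fin D), ch i ∉ G k)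
    (hGo : ∀ k, o ∉ G k)
    (R : κ → Finset (Fin n)) (hRA : ∀ k, R k ⊆ A.erase o) (hRdisj : ∀ k k', k ≠ k' → Disjoint (R k) (R k'))
    (lv : κ → ℕ) (hlv : ∀ k, lv k ≤ D)
    (hpath : ∀ k, ∀ b ∈ R k, (Finset.range (depth b + 1)).image (fun i => par^[i] b) =
      ((Finset.univ : Finset (Fin D)).filter (fun i : Fin D => i.val < lv k)).image ch ∪ G k)
    (hstrong : ∀ k, (R k).Nonempty → (2 * (j - 1 : ℕ) : ℝ) < (∑ k', ((R k').card : ℝ)) * ∏ y ∈ G k, (w s(par y, y) : ℝ))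
    (hne : ∃ k, (R k).Nonempty)
    (ht : ∀ b ∈ A, (prodBernoulli w).real (openConn o b : Set (BondConfig (Fin n)))ᶜ ≤ t) :
    (prodBernoulli w).real {ω : BondConfig (Fin n) | (A.filter fun b => ω ∈ openConn o b).card ≤ j} ≤ t := by
  have ht0 : 0 ≤ t := le_trans measureReal_nonneg (ht o hoA)
  have hcard := QuantCensus.card_filter_conn_eq_erase_add_one A o hoA
  have hoA' : o ∉ A.erase o := Finset.notMem_erase o A
  rcases Nat.eq_zero_or_pos j with hj | hj
  · subst hj
    have hempty : {ω : BondConfig (Fin n) | (A.filter fun b => ω ∈ openConn o b).card ≤ 0} = ∅ := by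
      rw [Set.eq_empty_iff_forall_notMem]
      intro ω hω
      have h1 := hcard ω
      have h2 : (A.filter fun b => ω ∈ openConn o b).card ≤ 0 := hω
      omega
    rw [hempty, measureReal_empty]
    exact ht0
  · obtain ⟨j', rfl⟩ : ∃ j', j = j' + 1 := ⟨j - 1, by omega⟩
    have hstrong' : ∀ k, (R k).Nonempty → (2 * j' : ℝ) < (∑ k', ((R k').card : ℝ)) * ∏ y ∈ G k, (w s(par y, y) : ℝ) := by
      intro k hk; have := hstrong k hk; simpa using this
    have hfar := farRelayRow_tree_blockComb_strong n w o depth par hroot hstep hsupp (A.erase o) hoA' j' t D ch hch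
      G hGdisj hGch hGo R hRA hRdisj lv hlv hpath hstrong' hne (fun b hb => ht b (Finset.mem_of_mem_erase hb))
    have hset : {ω : BondConfig (Fin n) | (A.filter fun b => ω ∈ openConn o b).card ≤ j' + 1} =
        {ω | ((A.erase o).filter fun b => ω ∈ openConn o b).card ≤ j'} := by
      ext ω
      simp only [Set.mem_setOf_eq]
      rw [hcard ω]
      omega
    rw [hset]
    exact hfar

end Quant

end Summit.CriticalPhenomena.PercolationContinuityZ3.Theorems
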